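import Summits.QuantumFields.YangMills.Theorems.BackwardLiouvilleRigidityHeightwiseRealisation
import Literature.MathematicalPhysics.QuantumFieldTheory.Balaban1983to89.T3MinimiserStabilityReduction
import Literature.MathematicalPhysics.QuantumFieldTheory.Balaban1983to89.T3PrintedRegularMinimiser
import Summits.QuantumFields.YangMills.Theorems.FluctuationComparisonRegPrIntLRunPairOrganIntegralOfTV
import Summits.QuantumFields.YangMills.Theorems.FluctuationComparisonRegPrIntLFixedHeightFloorWindowLogRatioTV

/-!
# LINE «fixed-height floor» (seat ym-r3-idea-1, g14, lens «control») — skeleton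

Target closed BY NAME by the composition `yM3TorusSU2_of_stubs`:
`Literature.MathematicalPhysics.QuantumFieldTheory.Balaban1983to89.T3YM3TorusStatement.YM3TorusSU2` (the R3 leaf).
No summit, rung or crux is proved by this file; `YM3TorusSU2` is NOT proved (three `sorry`d stubs: Hc, Hq, T; V and `IntegralOfTV` are LANDED and used BY NAME).

v4 (2026-08-28T22:4xZ): T `RunWindowTails` RE-TYPED with a p₀-THRESHOLD `∃ pT > 0, ∀ b₀ p₀, 0 < b₀ → pT ≤ p₀ → …` (v3 had `0 < p₀`:
FALSE for `p₀ ≤ 1/2` — the window `θBal` then loses against the `L^{3j}` site count and the tails are not summable); the composition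
takes `p₀ := max pm pT`.  Print's expansion order is «≤ 6 in g» ([Balaban1985UV3] p.261), not «three loops» — see
`Lines/fixed_height_floor_stage2.md`.  REGISTRY: v3 (sha 00a2d5b2) stays the registered text; v4 NOT re-registered (see the card).

CONTROLLING QUANTITY: the FLOOR `j ↦ φ j + η j` (order-σ non-expanded remainder + window tails at height `j`, uniform in the cut-off)
and the DOUBLE LIMIT `limsup_{K ≤ K' → ∞} |E_K − E_{K'}| ≤ floor(j)`, then `j → ∞`.  The two runs are compared at a FIXED height `j`
(volume at the comparison height CONSTANT in `K`), for ARBITRARY pairs `K ≤ K'`, RATE-FREE: H `FixedHeightCauchyFloor` (⇐ the two registered analytic stubs `stub_classicalActionCauchy` Hc (L) and `stub_quantumCauchyFloor` Hq (XL)) asks only that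
the window log-densities of the runs be Cauchy in `K` up to the floor `φ j` (modulo constants).  No organ, no adaptive height, no summable
radii, no UV-equivalence rate.  This is the trunk's King-type two-run slack ([King1986] Thm 3.4 (3.9): rate term + `(L^kε)^σ|T|` slack;
v5kC `stub_globalTwoRunSlackFamChi`, σ ≥ 7) read for arbitrary pairs with the rate `L^{−a(K−n)}` replaced by `o_{K→∞}(1)` and used at
fixed `n` only — the summability-in-`K` architecture (growing comparison height `⌊K/m⌋`, tilt radii) is replaced by the double limit.
-/

open MeasureTheory Filter Topology
open Literature.MathematicalPhysics.QuantumFieldTheory.Balaban1983to89 T3ContinuumYM3Torus T3NestedUnitLaws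
  T3UnitLawDensityEML T4Continuum BalabanUVClass T3UnitScaleTilt T3PrintedRegularMinimiser

namespace Summit.QuantumFields.YangMills.Cruxes.FluctuationComparisonRegPrIntL.FixedHeightFloor

/-- Hc · CLASSICAL ACTION CAUCHY (rate-free, fixed height, arbitrary pairs; L): the scaled constrained minimal Wilson actions
`β_K · minActionRegPr F j K _ ε₀ V` (the actions of Bałaban's background fields `U_{K−j}(V)` of runs `K`, [Balaban1985Variational] Thm 1 over the
space (6)) converge as `K → ∞` at every FIXED height `j`, uniformly on Bałaban's window, modulo constants: for late pairs `K ≤ K'` the difference is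
`≤ ε`.  This is the classical (tree-level) part of the two-run comparison — the rate-free, arbitrary-pair, fixed-height reading of the trunk's
`MinimiserStabilityRegPr` (19200: consecutive runs, summable rate, adaptive height).  Abelian analogue: [King1986] Prop. 3.10 (with a rate;
in-tree `King1986.EffectiveLaplacianRate.prop310_uniform_bound`).  Why it might fail: uniformity on the window of the classical continuum limit of
CONSTRAINED minimisers needs the analytic dependence of `U_k(V)` on `V` [Balaban1985Variational] Thm 1 with `k`-uniform constants AND convergence of
the `k`-step Green's functions [Balaban1985PropagatorsII] (1.33) — printed as bounds, the limit statement is not printed for d = 3 non-abelian. -/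
def ClassicalActionCauchy : Prop :=
  ∃ pm : ℝ, 0 < pm ∧ ∀ (p₀ : ℝ), pm ≤ p₀ → ∃ bm : ℝ, 0 < bm ∧ ∀ (b₀ : ℝ), bm ≤ b₀ →
    ∃ ε₁ : ℝ, 0 < ε₁ ∧ ∀ (ε₀ : ℝ), 0 < ε₀ → ε₀ ≤ ε₁ → ∃ γ₁ : ℝ, 0 < γ₁ ∧ ∀ (F : T3Family) (γ : ℝ), 0 < γ → γ ≤ γ₁ →
      ∀ (j : ℕ) (ε : ℝ), 0 < ε → ∃ K₀ : ℕ, j ≤ K₀ ∧ ∀ (K K' : ℕ), K₀ ≤ K → K ≤ K' → ∀ (hjK : j ≤ K) (hjK' : j ≤ K'),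
        ∃ c : ℝ, ∀ V : GaugeField (F.P j) 0 (Matrix.specialUnitaryGroup (Fin 2) ℂ), PlaqSmall (θBal F.L γ b₀ p₀ j) V →
          |(F.scheme ℰp γ).β K * minActionRegPr F j K hjK ε₀ V
              - (F.scheme ℰp γ).β K' * minActionRegPr F j K' hjK' ε₀ V - c| ≤ ε

/-- Hq · QUANTUM CAUCHY-UP-TO-FLOOR (THE CORE, XL): the nested laws of the runs have densities positive on Bałaban's windows, and at every FIXED
height `j` the FLUCTUATION PART of the window log-density, `log ρ_{K,j} + β_K · minActionRegPr F j K _ ε₀` ([Balaban1985UV3] (41) expands around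
exactly this background), is Cauchy in the run index `K` modulo constants UP TO a floor `φ j → 0` (the cut-off-uniform order-σ remainder, σ ≥ 7 by
d = 3 power counting, plus the relative weight of large-field histories above `j`): rate-free, arbitrary pairs.  Why it might fail: the order-σ
small-field representation with `K`-uniform remainder is printed for d = 4 to β-function order ([Balaban1988Convergent] CMP 119) and for d = 3 only as
O(1)|T| bounds ([Balaban1985UV3] (41)/(47)); the convergence (no rate needed) of the explicit ≤ 3-loop terms requires them written through the
`k`-step linear data ([Balaban1984PropagatorsI] §3, [Balaban1985PropagatorsII] (1.33)). -/
def QuantumCauchyFloor : Prop :=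
  ∃ pm : ℝ, 0 < pm ∧ ∀ (p₀ : ℝ), pm ≤ p₀ → ∃ bm : ℝ, 0 < bm ∧ ∀ (b₀ : ℝ), bm ≤ b₀ →
    ∃ ε₁ : ℝ, 0 < ε₁ ∧ ∀ (ε₀ : ℝ), 0 < ε₀ → ε₀ ≤ ε₁ → ∃ γ₁ : ℝ, 0 < γ₁ ∧ ∀ (F : T3Family) (γ : ℝ), 0 < γ → γ ≤ γ₁ →
    ∀ (ν : ℕ → (j : ℕ) → Measure (GaugeField (F.P j) 0 (Matrix.specialUnitaryGroup (Fin 2) ℂ))),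
      (∀ K, ν K K = T4GenFunBounds.gibbsMeasure (F.P K) ((F.scheme ℰp γ).β K)) →
      (∀ K j, j < K → ν K j = Measure.map (descend F ℰp j) (ν K (j + 1))) →
      ∃ ρ : ℕ → (j : ℕ) → GaugeField (F.P j) 0 (Matrix.specialUnitaryGroup (Fin 2) ℂ) → ℝ,
        (∀ (K j : ℕ), j ≤ K →
          Measurable (ρ K j) ∧ (∀ U, 0 ≤ ρ K j U) ∧ (∀ U, PlaqSmall (θBal F.L γ b₀ p₀ j) U → 0 < ρ K j U) ∧
          ν K j = (fieldMeasure _ _ _).withDensity (fun U => ENNReal.ofReal (ρ K j U))) ∧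
        ∃ φ : ℕ → ℝ, Tendsto φ atTop (𝓝 0) ∧
          ∀ (j : ℕ) (ε : ℝ), 0 < ε → ∃ K₀ : ℕ, j ≤ K₀ ∧ ∀ (K K' : ℕ), K₀ ≤ K → K ≤ K' → ∀ (hjK : j ≤ K) (hjK' : j ≤ K'),
            ∃ c : ℝ, ∀ U, PlaqSmall (θBal F.L γ b₀ p₀ j) U →
              |(Real.log (ρ K j U) + (F.scheme ℰp γ).β K * minActionRegPr F j K hjK ε₀ U)
                - (Real.log (ρ K' j U) + (F.scheme ℰp γ).β K' * minActionRegPr F j K' hjK' ε₀ U) - c| ≤ φ j + ε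

/-- H · FIXED-HEIGHT CAUCHY UP TO A FLOOR (the core; rate-free, arbitrary pairs, fixed height): for large exponents `p₀` there are a
window constant `b₀` and a coupling threshold such that for every family and coupling the nested laws `ν K j` of the runs have densities
`ρ K j` (w.r.t. product Haar; measurable, nonnegative, positive on Bałaban's window `PlaqSmall (θBal … j)`), and there is a FLOOR
`φ → 0` such that AT EVERY FIXED HEIGHT `j`, for every `ε > 0`, all sufficiently late pairs of runs `K₀ ≤ K ≤ K'` satisfy
`sup_window |log ρ K j − log ρ K' j − c| ≤ φ j + ε` for some constant `c = c(K,K',j)`.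
Mechanism: Bałaban's inductive representation of the window density at height `j` after `k = K − j` steps = an explicit functional
(classical background action with prefactor `β_j`, Gaussian normalisations, the expansion terms through three loops) of the `k`-step
LINEAR DATA (background-field propagators, minimisers, averaging kernels), which CONVERGE as `k → ∞` at fixed height ([Balaban1984PropagatorsI]
§3, [Balaban1985PropagatorsII] (1.33), [Balaban1985Variational] Thm 1) — continuity gives the `ε`; plus NON-CONVERGENT but `K`-UNIFORM parts
absorbed by the floor: the order-σ remainder `C θ(j)^σ #Site_j` (σ ≥ 7 beats the volume: `(g_j p)^σ L^{3j} → 0`, d = 3 power counting) and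
the relative weight `Σ_{i>j} L^{3i} e^{−c p(g_i)²}` of large-field histories above `j`.  Abelian analogue in print: [King1986] Thm 3.1 + 3.4 at
fixed `m` (floor `(L^kε_K)^σ|T| = ε_m^σ|T|`), typed in the tree as `King1986.ContinuumLimit.RGData.Thm34Printed`.
Why it might fail: the order-σ (three-loop-explicit) small-field representation with `K`-uniform remainder is printed for d = 4 to the
order of the β-function ([Balaban1988Convergent] = CMP 119) and for d = 3 only as O(1)|T|-bounds ([Balaban1985UV3] (41)/(47)); the pointwise
relative smallness of large-field histories ON the window is read off the inductive `T`-operation bounds, not printed as such. XL. -/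
def FixedHeightCauchyFloor : Prop :=
  ∃ pm : ℝ, 0 < pm ∧ ∀ (p₀ : ℝ), pm ≤ p₀ → ∃ b₀ : ℝ, 0 < b₀ ∧ ∃ γ₁ : ℝ, 0 < γ₁ ∧ ∀ (F : T3Family) (γ : ℝ), 0 < γ → γ ≤ γ₁ →
    ∀ (ν : ℕ → (j : ℕ) → Measure (GaugeField (F.P j) 0 (Matrix.specialUnitaryGroup (Fin 2) ℂ))),
      (∀ K, ν K K = T4GenFunBounds.gibbsMeasure (F.P K) ((F.scheme ℰp γ).β K)) →
      (∀ K j, j < K → ν K j = Measure.map (descend F ℰp j) (ν K (j + 1))) →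
      ∃ ρ : ℕ → (j : ℕ) → GaugeField (F.P j) 0 (Matrix.specialUnitaryGroup (Fin 2) ℂ) → ℝ,
        (∀ (K j : ℕ), j ≤ K →
          Measurable (ρ K j) ∧ (∀ U, 0 ≤ ρ K j U) ∧ (∀ U, PlaqSmall (θBal F.L γ b₀ p₀ j) U → 0 < ρ K j U) ∧
          ν K j = (fieldMeasure _ _ _).withDensity (fun U => ENNReal.ofReal (ρ K j U))) ∧
        ∃ φ : ℕ → ℝ, Tendsto φ atTop (𝓝 0) ∧
          ∀ (j : ℕ) (ε : ℝ), 0 < ε → ∃ K₀ : ℕ, j ≤ K₀ ∧ ∀ (K K' : ℕ), K₀ ≤ K → K ≤ K' →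
            ∃ c : ℝ, ∀ U, PlaqSmall (θBal F.L γ b₀ p₀ j) U →
              |Real.log (ρ K j U) - Real.log (ρ K' j U) - c| ≤ φ j + ε

/-- T · RUN WINDOW TAILS (shared BY STATEMENT with `Lines/runpair_organ.lean` S1b) (per height, uniformly in the cut-off): the nested laws give Bałaban's window complement at height `j` a mass
`≤ η j`, summable in `j`, for every run `K ≥ j`.  Per block size this is the union bound over the FIRST-EXIT events of
`FirstExitWindow.FirstExitWindowTailL` (stmt 26243) summed over the finer heights; not printed as a probability estimate
([Balaban1985UV3] (71) p.46 gives the density-level large-field smallness). M given 26243 / L–XL outright. -/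
def RunWindowTails : Prop :=
  ∃ pT : ℝ, 0 < pT ∧ ∀ (b₀ p₀ : ℝ), 0 < b₀ → pT ≤ p₀ → ∃ γ₁ : ℝ, 0 < γ₁ ∧ ∀ (F : T3Family) (γ : ℝ), 0 < γ → γ ≤ γ₁ →
    ∃ η : ℕ → ℝ, (∀ j, 0 ≤ η j) ∧ Summable η ∧
      ∀ (ν : ℕ → (j : ℕ) → Measure (GaugeField (F.P j) 0 (Matrix.specialUnitaryGroup (Fin 2) ℂ))),
        (∀ K, ν K K = T4GenFunBounds.gibbsMeasure (F.P K) ((F.scheme ℰp γ).β K)) →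
        (∀ K j, j < K → ν K j = Measure.map (descend F ℰp j) (ν K (j + 1))) →
        ∀ (K j : ℕ), j ≤ K → ν K j {U | ¬ PlaqSmall (θBal F.L γ b₀ p₀ j) U} ≤ ENNReal.ofReal (η j)

/-- V · WINDOW LOG-RATIO ⇒ SET-CLOSENESS (termination; measure theory on one height): two probability laws with Haar-densities that are
positive on a window, whose log-ratio is constant up to `τ` on the window and whose window complements have mass `≤ η`, are `ε`-close on
every measurable set once `τ, η ≤ δ(ε)`.  (Proof sketch: `|c| ≤ τ + log(1/(1−η))` from the two normalisations; then
`|μ A − μ' A| ≤ (e^{|c|+τ} − 1) + 2η`.)  S/M, Mathlib-level. -/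
def WindowLogRatioTV : Prop :=
  ∀ ε : ℝ, 0 < ε → ∃ δ : ℝ, 0 < δ ∧ ∀ (F : T3Family) (j : ℕ) (θ : ℝ)
    (μ μ' : Measure (GaugeField (F.P j) 0 (Matrix.specialUnitaryGroup (Fin 2) ℂ)))
    (ρ ρ' : GaugeField (F.P j) 0 (Matrix.specialUnitaryGroup (Fin 2) ℂ) → ℝ),
    IsProbabilityMeasure μ → IsProbabilityMeasure μ' → Measurable ρ → Measurable ρ' →
    (∀ U, 0 ≤ ρ U) → (∀ U, 0 ≤ ρ' U) → (∀ U, PlaqSmall θ U → 0 < ρ U ∧ 0 < ρ' U) →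
    μ = (fieldMeasure _ _ _).withDensity (fun U => ENNReal.ofReal (ρ U)) →
    μ' = (fieldMeasure _ _ _).withDensity (fun U => ENNReal.ofReal (ρ' U)) →
    ∀ (c τ η : ℝ), 0 ≤ τ → τ ≤ δ → 0 ≤ η → η ≤ δ →
    (∀ U, PlaqSmall θ U → |Real.log (ρ U) - Real.log (ρ' U) - c| ≤ τ) →
    μ {U | ¬ PlaqSmall θ U} ≤ ENNReal.ofReal η → μ' {U | ¬ PlaqSmall θ U} ≤ ENNReal.ofReal η →
    ∀ A : Set (GaugeField (F.P j) 0 (Matrix.specialUnitaryGroup (Fin 2) ℂ)), MeasurableSet A → |μ.real A - μ'.real A| ≤ ε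

/-! ## Registered stubs -/

theorem stub_classicalActionCauchy : ClassicalActionCauchy := by
  sorry

theorem stub_quantumCauchyFloor : QuantumCauchyFloor := by
  sorry

theorem stub_runWindowTails : RunWindowTails := by  -- v4: p₀-threshold `pT ≤ p₀` (was `0 < p₀`, false for p₀ ≤ 1/2 by site counting)
  sorry

/-- V is LANDED (p672092, `Theorems/FluctuationComparisonRegPrIntLFixedHeightFloorWindowLogRatioTV.lean`): discharged BY NAME. -/
theorem stub_windowLogRatioTV : WindowLogRatioTV :=
  Summit.QuantumFields.YangMills.Theorems.FluctuationComparisonRegPrIntL.FixedHeightFloor.stub_windowLogRatioTV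

/-- H ⇐ Hc ∧ Hq (triangle inequality; thresholds merged by `max`/`min`; the floor is Hq's). -/
theorem fixedHeightCauchyFloor_of_classical_quantum (hc : ClassicalActionCauchy) (hq : QuantumCauchyFloor) :
    FixedHeightCauchyFloor := by
  obtain ⟨pmc, hpmc, hc⟩ := hc
  obtain ⟨pmq, hpmq, hq⟩ := hq
  refine ⟨max pmc pmq, lt_max_of_lt_left hpmc, fun p₀ hp₀ => ?_⟩
  obtain ⟨bmc, hbmc, hc⟩ := hc p₀ ((le_max_left _ _).trans hp₀)
  obtain ⟨bmq, hbmq, hq⟩ := hq p₀ ((le_max_right _ _).trans hp₀)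
  obtain ⟨ε₁c, hε₁c, hc⟩ := hc (max bmc bmq) (le_max_left _ _)
  obtain ⟨ε₁q, hε₁q, hq⟩ := hq (max bmc bmq) (le_max_right _ _)
  have hε₀ : 0 < min ε₁c ε₁q := lt_min hε₁c hε₁q
  obtain ⟨γc, hγc, hc⟩ := hc (min ε₁c ε₁q) hε₀ (min_le_left _ _)
  obtain ⟨γq, hγq, hq⟩ := hq (min ε₁c ε₁q) hε₀ (min_le_right _ _)
  refine ⟨max bmc bmq, lt_max_of_lt_left hbmc, min γc γq, lt_min hγc hγq, fun F γ hγ hγ₁ ν hν1 hν2 => ?_⟩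
  have hcF := hc F γ hγ (hγ₁.trans (min_le_left _ _))
  obtain ⟨ρ, hρ, φ, hφ, hqF⟩ := hq F γ hγ (hγ₁.trans (min_le_right _ _)) ν hν1 hν2
  refine ⟨ρ, hρ, φ, hφ, fun j ε hε => ?_⟩
  obtain ⟨K₀c, hjc, hKc⟩ := hcF j (ε / 2) (by positivity)
  obtain ⟨K₀q, hjq, hKq⟩ := hqF j (ε / 2) (by positivity)
  refine ⟨max K₀c K₀q, hjc.trans (le_max_left _ _), fun K K' hK hKK' => ?_⟩
  have hjK : j ≤ K := hjc.trans ((le_max_left _ _).trans hK)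
  have hjK' : j ≤ K' := hjK.trans hKK'
  obtain ⟨cc, hcc⟩ := hKc K K' ((le_max_left _ _).trans hK) hKK' hjK hjK'
  obtain ⟨cq, hcq⟩ := hKq K K' ((le_max_right _ _).trans hK) hKK' hjK hjK'
  refine ⟨cq - cc, fun U hU => ?_⟩
  have h1 := hcc U hU
  have h2 := hcq U hU
  rw [abs_le] at h1 h2 ⊢
  constructor <;> linarith [h1.1, h1.2, h2.1, h2.2]

/-- H from the two registered analytic stubs. -/
theorem fixedHeightCauchyFloor_of_stubs : FixedHeightCauchyFloor :=
  fixedHeightCauchyFloor_of_classical_quantum stub_classicalActionCauchy stub_quantumCauchyFloor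

/-! ## Composition -/

/-- COMPOSITION (kernel-checked, no `sorry` outside the stubs): the three registered stubs, introduced by name, and the LANDED
`IntegralOfTV` (p670105) decide the R3 leaf BY NAME — double limit: height `j` with small floor first, then late pairs of runs. -/
theorem yM3TorusSU2_of_stubs :
    Literature.MathematicalPhysics.QuantumFieldTheory.Balaban1983to89.T3YM3TorusStatement.YM3TorusSU2 := by
  classical
  have h1 : FixedHeightCauchyFloor := fixedHeightCauchyFloor_of_stubs
  have h2 : RunWindowTails := stub_runWindowTails
  have h3 : WindowLogRatioTV := stub_windowLogRatioTV
  have h4 : Summit.QuantumFields.YangMills.Theorems.FluctuationComparisonRegPrIntL.RunPairOrgan.IntegralOfTV :=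
    Summit.QuantumFields.YangMills.Theorems.FluctuationComparisonRegPrIntL.RunPairOrgan.stub_integralOfTV
  obtain ⟨pm, hpm, H1⟩ := h1
  obtain ⟨pT, hpT, h2⟩ := h2
  obtain ⟨b₀, hb₀, γa, hγa, H1⟩ := H1 (max pm pT) (le_max_left _ _)
  obtain ⟨γb, hγb, H2⟩ := h2 b₀ (max pm pT) hb₀ (le_max_right _ _)
  refine ⟨min (min γa γb) 1, by positivity, ?_⟩
  intro F γ hγ hle
  have hγa' : γ ≤ γa := hle.trans ((min_le_left _ _).trans (min_le_left _ _))
  have hγb' : γ ≤ γb := hle.trans ((min_le_left _ _).trans (min_le_right _ _))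
  rw [Literature.MathematicalPhysics.QuantumFieldTheory.Balaban1983to89.T3ContinuumYM3Torus.continuumYM3Torus_iff_hasContinuumLimit_SU
    F Literature.MathematicalPhysics.QuantumFieldTheory.Balaban1983to89.T3UnitLawDensityEML.ℰp
    Literature.MathematicalPhysics.QuantumFieldTheory.Balaban1983to89.T3UnitLawDensityEML.measurableE_ℰp hγ.le]
  intro os
  -- nested laws of the runs, their densities and the floor (H), the window tails (T)
  obtain ⟨ν, hν1, hν2, hν3⟩ :=
    Summit.QuantumFields.YangMills.Theorems.BackwardLiouvilleRigidityHeightwiseRealisation.exists_nestedLaws F hγ.le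
  obtain ⟨ρ, hρ, φ, hφ, Hc⟩ := H1 F γ hγ hγa' ν hν1 hν2
  obtain ⟨η, hη0, hηs, Hη⟩ := H2 F γ hγ hγb'
  have Hη := Hη ν hν1 hν2
  have hη_lim : Tendsto η atTop (𝓝 0) := hηs.tendsto_atTop_zero
  -- the unit-scale expectations form a Cauchy sequence
  apply cauchySeq_tendsto_of_complete
  rw [Metric.cauchySeq_iff']
  intro t ht
  obtain ⟨δ₀, hδ₀, HTV⟩ := h3 (t / 8) (by positivity)
  -- FIRST LIMIT: a height j whose floor is below δ₀
  have e1 : ∀ᶠ j : ℕ in atTop, φ j < δ₀ / 2 := hφ.eventually (Iio_mem_nhds (by positivity))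
  have e2 : ∀ᶠ j : ℕ in atTop, η j < δ₀ := hη_lim.eventually (Iio_mem_nhds hδ₀)
  obtain ⟨j, hj1, hj2⟩ := (e1.and e2).exists
  -- SECOND LIMIT: late pairs of runs at that height
  obtain ⟨K₀, hjK, HK⟩ := Hc j (δ₀ / 2) (by positivity)
  refine ⟨K₀, fun K' hK' => ?_⟩
  have hjK' : j ≤ K' := hjK.trans hK'
  obtain ⟨c, hc⟩ := HK K₀ K' le_rfl hK'
  obtain ⟨m1, n1, p1, w1⟩ := hρ K₀ j hjK
  obtain ⟨m2, n2, p2, w2⟩ := hρ K' j hjK'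
  have hTVj := HTV F j (θBal F.L γ b₀ (max pm pT) j) (ν K₀ j) (ν K' j) (ρ K₀ j) (ρ K' j) (hν3 K₀ j) (hν3 K' j) m1 m2 n1 n2
    (fun U hU => ⟨p1 U hU, p2 U hU⟩) w1 w2 c δ₀ (η j) hδ₀.le le_rfl (hη0 j) hj2.le
    (fun U hU => (hc U hU).trans (by linarith)) (Hη K₀ j hjK) (Hη K' j hjK')
  -- observables: bounded by one and measurable
  have hℰ := F.avgMeasurable_of_measurableE ℰp measurableE_ℰp
  have hmeas : ∀ os' : List (ULoop3 F), Measurable fun u : GaugeField (F.P j) 0 (Matrix.specialUnitaryGroup (Fin 2) ℂ) =>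
      (os'.map fun C => F.avgObs ℰp j C u).prod := by
    intro os'
    induction os' with
    | nil => simp
    | cons C t ih =>
      simp only [List.map_cons, List.prod_cons]
      exact (F.measurable_avgObs hℰ j C).mul ih
  have hbd : ∀ (os' : List (ULoop3 F)) (u : GaugeField (F.P j) 0 (Matrix.specialUnitaryGroup (Fin 2) ℂ)),
      |(os'.map fun C => F.avgObs ℰp j C u).prod| ≤ 1 := by
    intro os' u
    induction os' with
    | nil => simp
    | cons C t ih =>
      simp only [List.map_cons, List.prod_cons, abs_mul]
      exact mul_le_one₀ (F.abs_avgObs_le_one ℰp j C u) (abs_nonneg _) ih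
  have hint := h4 F j (ν K₀ j) (ν K' j) (hν3 K₀ j) (hν3 K' j) (t / 8) (by positivity) hTVj
    (fun u => (os.map fun C => F.avgObs ℰp j C u).prod) (hmeas os) (hbd os)
  beta_reduce at hint
  rw [Summit.QuantumFields.YangMills.Theorems.BackwardLiouvilleRigidityHeightwiseRealisation.integral_prod_avgObs_nestedLaw
      F hγ.le ν hν1 hν2 K₀ os j hjK,
    Summit.QuantumFields.YangMills.Theorems.BackwardLiouvilleRigidityHeightwiseRealisation.integral_prod_avgObs_nestedLaw
      F hγ.le ν hν1 hν2 K' os j hjK'] at hint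
  rw [Real.dist_eq, abs_sub_comm]
  linarith

end Summit.QuantumFields.YangMills.Cruxes.FluctuationComparisonRegPrIntL.FixedHeightFloor
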